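import Literature.AlgebraicGeometry.HodgeTheory.PicardLefschetzOfMonodromyHomeomorphism
import Literature.AlgebraicGeometry.HodgeTheory.UniversalHypersurfaceTransportOfIsotopy
import HarnessLib

/-!
# One-nodal Picard–Lefschetz data from a projective isotopy of a pencil that localises to the `A₁` model
# (the TARGET SIGNATURE of the geometric half of the Picard–Lefschetz theorem, stated in homogeneous coordinates)

Family `hodge`, layer `Literature/AlgebraicGeometry/HodgeTheory`; proof file (theorems only, no definition, no named
fact). Written by the prover seat `hodge-nonav-prover-Bx` (g13, cell `hodge-nonav`) for crux K1-B
`VeryGeneralSignCommutatorsInHg` of the route `HodgeConjecture/SignSymmetricPowers` (stmt-HodgeConjecture-19716), binder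
`picardLefschetz_nodalForms_uniform`. It is the COMPOSITION of
`UniversalHypersurfaceTransportOfIsotopy.exists_homeomorph_isRatTransport_of_isotopy` (a projective isotopy of the zero sets
over a loop computes the rational transport) with
`PicardLefschetzOfMonodromyHomeomorphism.exists_isPicardLefschetzData_one_of_homotopyConj_antipodal` (a monodromy
homeomorphism which is the identity off an open set `A` and, on `A`, homotopy-conjugate through an `H_{m+1}`-injective chart to
the antipodal map of the quadric `Σ zⱼ² = 1`, yields one-nodal Picard–Lefschetz data), with EVERYTHING stated on the
projective zero set `{[z] | F_s(z) = 0} ⊆ ℙ(ℂᵐ⁺³)` — the form in which a geometric construction (flows on the regular locus, an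
explicit formula, …) delivers its output. So the seat that constructs the geometric monodromy of a pencil of hypersurfaces
near an ordinary double point has ONE theorem to target:

* **`exists_isPicardLefschetzData_one_of_pencilIsotopy`** — data: `m, d ≥ 1`, `hU`, a loop `γ` at `s`, projective self-maps
  `h u, k u` (`u ∈ [0,1]`) with the six hypotheses of `exists_homeomorph_isRatTransport_of_isotopy`; an open cover `A ∪ B` of the
  zero set `Z_s = {F_s = 0}` with `k 1 = id` on `B` and `k 1 (A) ⊆ A` (restriction `κA : C(A, A)`), a continuous
  `κ : C(Z_s, Z_s)` reading `k 1`, a chart `e : C(A, {Σ_{j<m+2} zⱼ² = 1})` injective on `H_{m+1}( · ; ℚ)`, an antipodal `g`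
  with `e ∘ κA ≃ g ∘ e`, and `Odd (m+1) ∨ κ^* ≠ id` on `H^{m+1}(Z_s; ℚ)`. Conclusion: `∃ δ c, IsPicardLefschetzData (m+1) d 1 … γ ![δ] c`.

What is NOT here (the print content that remains for `picardLefschetz_nodalForms_uniform` at one node): the CONSTRUCTION of such
`h, k, A, B, e` for the pencil `f₁ + c g` near an ordinary double point of `f₁` (Ehresmann's theorem with boundary condition
over the circle and the Milnor-fibre model; Voisin II §2.3, §3.2.1; AGZV II Part I §1–§2).

## References

* [VoisinHodgeII2003] C. Voisin, Hodge Theory and Complex Algebraic Geometry II, CUP 2003, §3.2.1 Thm. 3.16, Cor. 3.17,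
  Rem. 3.21; §2.3.1–2.3.3.
* [VoisinHodgeI2002] C. Voisin, Hodge Theory and Complex Algebraic Geometry I, CUP 2002, §9.2.1 Prop. 9.5.
* [ArnoldGuseinzadeVarchenko2012] V. I. Arnold, S. M. Gusein-Zade, A. N. Varchenko, Singularities of Differentiable Maps
  II (2012 reprint), Part I §1.1–§1.3, §2.1.
* [Lamotke1981] K. Lamotke, The topology of complex projective varieties after S. Lefschetz, Topology 20 (1981), §5–§6.
-/

noncomputable section

open CategoryTheory AlgebraicGeometry ContinuousMap
open _root_.Topology
open scoped unitInterval LinearAlgebra.Projectivization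
open Literature.AlgebraicTopology.SingularHomology Literature.Geometry.ComplexAnalytic
open Literature.AlgebraicGeometry.Motives Literature.AlgebraicGeometry.Motives.UniversalHypersurface

namespace Literature.AlgebraicGeometry.HodgeTheory

section HodgeTheory

variable {m d : ℕ}

/-- **One-nodal Picard–Lefschetz data from a localised pencil isotopy, in homogeneous coordinates.** See the module
docstring for the list of data. The monodromy homeomorphism `η⁻¹` of `Y_s(ℂ)` (reading `k 1`) is produced by
`exists_homeomorph_isRatTransport_of_isotopy`; the open cover, the identity off `A`, the chart and the antipodal conjugacy are
pulled back along `Y_s(ℂ) ≃ₜ {F_s = 0}` (`exists_homeomorph_fibrePoint`); then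
`exists_isPicardLefschetzData_one_of_homotopyConj_antipodal` applies with `T = Hᵐ⁺¹(η⁻¹)`.
[cite: VoisinHodgeII2003, §3.2.1 Thm. 3.16 and Cor. 3.17] [cite: VoisinHodgeI2002, §9.2.1 Prop. 9.5]
[cite: ArnoldGuseinzadeVarchenko2012, Part I §1.3 and §2.1] -/
theorem exists_isPicardLefschetzData_one_of_pencilIsotopy (hd : 1 ≤ d)
    (hU : IsCohomologicallyLocallyTrivialOn (family ℂ (m + 1) d) Set.univ)
    {s : ComplexPoints (base ℂ (m + 1) d)} (γ : Path s s)
    (h k : I → ℙ ℂ (Fin (m + 1 + 2) → ℂ) → ℙ ℂ (Fin (m + 1 + 2) → ℂ))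
    (hhc : Continuous fun uy : I × {ℓ // ℓ ∈ Projectivization.projZeroLocus {pointForm ℂ (m + 1) d s}} =>
      h uy.1 uy.2.1)
    (hh0 : ∀ ℓ ∈ Projectivization.projZeroLocus {pointForm ℂ (m + 1) d s}, h 0 ℓ = ℓ)
    (hhm : ∀ u : I, ∀ ℓ ∈ Projectivization.projZeroLocus {pointForm ℂ (m + 1) d s},
      h u ℓ ∈ Projectivization.projZeroLocus {pointForm ℂ (m + 1) d (γ u)})
    (hkm : ∀ u : I, ∀ ℓ ∈ Projectivization.projZeroLocus {pointForm ℂ (m + 1) d (γ u)},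
      k u ℓ ∈ Projectivization.projZeroLocus {pointForm ℂ (m + 1) d s})
    (hkh : ∀ u : I, ∀ ℓ ∈ Projectivization.projZeroLocus {pointForm ℂ (m + 1) d s}, k u (h u ℓ) = ℓ)
    (hhk : ∀ u : I, ∀ ℓ ∈ Projectivization.projZeroLocus {pointForm ℂ (m + 1) d (γ u)}, h u (k u ℓ) = ℓ)
    -- the localisation data on the zero set `Z_s = {F_s = 0}`
    {A B : Set {ℓ // ℓ ∈ Projectivization.projZeroLocus {pointForm ℂ (m + 1) d s}}}
    (hAo : IsOpen A) (hBo : IsOpen B) (hAB : A ∪ B = Set.univ)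
    (hkB : ∀ z ∈ B, k 1 z.1 = z.1)
    (κ : C({ℓ // ℓ ∈ Projectivization.projZeroLocus {pointForm ℂ (m + 1) d s}},
      {ℓ // ℓ ∈ Projectivization.projZeroLocus {pointForm ℂ (m + 1) d s}}))
    (hκ : ∀ z, (κ z).1 = k 1 z.1)
    (κA : C(↥A, ↥A)) (hκA : ∀ a : ↥A, ((κA a : ↥A) : _) = κ a)
    (e : C(↥A, PhamBrieskorn.fibre (fun _ : Fin (m + 2) ↦ (2 : ℕ))))
    (hinj : Function.Injective (singularHomology.map ℚ ℚ e (m + 1)).hom)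
    (g : C(PhamBrieskorn.fibre (fun _ : Fin (m + 2) ↦ (2 : ℕ)), PhamBrieskorn.fibre (fun _ : Fin (m + 2) ↦ (2 : ℕ))))
    (hg : ∀ z, ((g z : PhamBrieskorn.fibre _) : Fin (m + 2) → ℂ) = -(z : Fin (m + 2) → ℂ))
    (hconj : (e.comp κA).Homotopic (g.comp e))
    (hnt : Odd (m + 1) ∨ ∃ v, (singularCohomology.map ℚ ℚ κ (m + 1)).hom v ≠ v) :
    ∃ (δ : bettiCohomology (fiberOver (family ℂ (m + 1) d) s) (m + 1)) (c : ℚ),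
      IsPicardLefschetzData (m + 1) d 1 (Nat.succ_pos m) hd hU γ ![δ] c := by
  -- the monodromy homeomorphism and its rational transport
  obtain ⟨η, hη, hηs, hT, hTv⟩ := exists_homeomorph_isRatTransport_of_isotopy (Nat.succ_pos m) hd hU γ h k hhc hh0 hhm
    hkm hkh hhk
  -- the fibre as the zero set
  obtain ⟨es, hes⟩ := exists_homeomorph_fibrePoint (n := m + 1) hd s
  -- `es ∘ η⁻¹ = κ ∘ es`
  have hrel : ∀ y, es (η.symm y) = κ (es y) := fun y =>
    Subtype.ext (by rw [hes, hηs, hκ, hes])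
  -- pull the localisation data back to `Y_s(ℂ)`
  let Y := ComplexPoints (fiberOver (family ℂ (m + 1) d) s)
  let Z : Type := {ℓ // ℓ ∈ Projectivization.projZeroLocus {pointForm ℂ (m + 1) d s}}
  let esC : C(Y, Z) := es
  let ηC : C(Y, Y) := η.symm
  have hesC : ∀ y, esC y = es y := fun _ => rfl
  have hηC : ∀ y, ηC y = η.symm y := fun _ => rfl
  let A' : Set Y := es ⁻¹' A
  let B' : Set Y := es ⁻¹' B
  have hA'o : IsOpen A' := hAo.preimage es.continuous
  have hB'o : IsOpen B' := hBo.preimage es.continuous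
  have hA'B' : A' ∪ B' = Set.univ := by
    ext y
    simp only [A', B', Set.mem_union, Set.mem_preimage, Set.mem_univ, iff_true]
    have : es y ∈ A ∪ B := by rw [hAB]; exact Set.mem_univ _
    exact this
  let hs : C(Y, Y) := (η.symm : C(Y, Y))
  have hhsB : ∀ y ∈ B', hs y = y := by
    intro y hy
    apply es.injective
    change es (η.symm y) = es y
    rw [hrel]
    exact Subtype.ext (by rw [hκ, hkB _ hy])
  -- the restriction of `η⁻¹` to `A'`
  have hmapsA : ∀ a : ↥A', hs a ∈ A' := by
    intro a
    change es (η.symm a) ∈ A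
    rw [hrel, ← hκA ⟨es a, a.2⟩]
    exact (κA ⟨es a, a.2⟩).2
  let hsA : C(↥A', ↥A') :=
    ⟨fun a => ⟨hs a, hmapsA a⟩, (hs.continuous.comp continuous_subtype_val).subtype_mk _⟩
  have hhsA : ∀ a : ↥A', ((hsA a : ↥A') : Y) = hs a := fun _ => rfl
  -- the chart: `A' ≃ₜ A` followed by `e`
  let r : ↥A' ≃ₜ ↥A := es.sets rfl
  have hr : ∀ a : ↥A', ((r a : ↥A) : _) = es a := fun _ => rfl
  let e' : C(↥A', PhamBrieskorn.fibre (fun _ : Fin (m + 2) ↦ (2 : ℕ))) := e.comp (r : C(↥A', ↥A))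
  have hinj' : Function.Injective (singularHomology.map ℚ ℚ e' (m + 1)).hom := by
    have hcomp : singularHomology.map ℚ ℚ e' (m + 1) =
        singularHomology.map ℚ ℚ (r : C(↥A', ↥A)) (m + 1) ≫ singularHomology.map ℚ ℚ e (m + 1) := by
      change singularHomology.map ℚ ℚ (e.comp (r : C(↥A', ↥A))) (m + 1) = _
      rw [singularHomology.map_comp]
    rw [hcomp, ModuleCat.hom_comp, LinearMap.coe_comp]
    exact hinj.comp (singularHomology.mapIso ℚ ℚ r (m + 1)).toLinearEquiv.injective
  -- the conjugacy: `r ∘ η⁻¹|_{A'} = κA ∘ r`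
  have hrconj : (r : C(↥A', ↥A)).comp hsA = κA.comp (r : C(↥A', ↥A)) := by
    refine ContinuousMap.ext fun a => Subtype.ext ?_
    change es (η.symm a) = ((κA (r a) : ↥A) : _)
    rw [hrel, hκA, hr]
  have hconj' : (e'.comp hsA).Homotopic (g.comp e') := by
    have h1 : e'.comp hsA = (e.comp κA).comp (r : C(↥A', ↥A)) := by
      change (e.comp (r : C(↥A', ↥A))).comp hsA = _
      rw [ContinuousMap.comp_assoc, hrconj, ← ContinuousMap.comp_assoc]
    have h2 : g.comp e' = (g.comp e).comp (r : C(↥A', ↥A)) := by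
      change g.comp (e.comp (r : C(↥A', ↥A))) = _
      rw [← ContinuousMap.comp_assoc]
    rw [h1, h2]
    exact hconj.comp (ContinuousMap.Homotopic.refl _)
  -- non-triviality for even middle dimension
  have hnt' : Odd (m + 1) ∨ (singularCohomology.mapIso ℚ ℚ η.symm (m + 1)).toLinearEquiv ≠ 1 := by
    rcases hnt with hodd | ⟨v, hv⟩
    · exact Or.inl hodd
    · refine Or.inr fun h1 => hv ?_
      -- `κ ∘ es = es ∘ η⁻¹`, so `es^* κ^* = (η⁻¹)^* es^* = es^*`, and `es^*` is injective
      have hce : κ.comp esC = esC.comp ηC :=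
        ContinuousMap.ext fun y => by rw [ContinuousMap.comp_apply, ContinuousMap.comp_apply, hesC, hesC, hηC, hrel]
      have hmaps : singularCohomology.map ℚ ℚ κ (m + 1) ≫ singularCohomology.map ℚ ℚ esC (m + 1) =
          singularCohomology.map ℚ ℚ esC (m + 1) ≫ singularCohomology.map ℚ ℚ ηC (m + 1) := by
        rw [← singularCohomology.map_comp, ← singularCohomology.map_comp, hce]
      have hid : ∀ w, (singularCohomology.map ℚ ℚ ηC (m + 1)).hom w = w := fun w => by
        have := hTv (m + 1) w
        rw [h1] at this
        exact this.symm
      have key := congrArg (fun φ => φ.hom v) hmaps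
      simp only [ModuleCat.hom_comp, LinearMap.coe_comp, Function.comp_apply, hid] at key
      exact (singularCohomology.mapIso ℚ ℚ es (m + 1)).toLinearEquiv.injective key
  exact exists_isPicardLefschetzData_one_of_homotopyConj_antipodal hd hU γ (hT (m + 1)) hA'o hB'o hA'B' hs hhsB hsA hhsA
    e' hinj' g hg hconj' (hTv (m + 1)) hnt'

end HodgeTheory

end Literature.AlgebraicGeometry.HodgeTheory

end
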